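import Summits.QuantumFields.YangMills.Theorems.UnitScaleTiltHalvingP1FlatCoreDP1Target
import HarnessLib

/-!
# Line H (`BirthV10.stub_halvingStep`), the (o)-dictionary OFF the window: under the top normalisation the charted field's
# double-bar top bond variables ARE the axial-contour transporters of the top average — on every bond of the (top)-set

Crux `stmt-QuantumFields-19200` (`MinimiserStabilityRegPr`), line `birth_v10`, pillar P1♭ clause (o); LEAD-H RULING L-9 (2) row (L4).
✓`P1FlatCoreDP1Target.dp1Clause_of_effGauge_eq_axialT_dbar` concludes `DP1Clause` — the identity
`W̿^{(k)}((U♯)^{u⁻¹})(c) = V̄♯(Γ_{y₀,c₋} ∪ c ∪ Γ_{c₊,y₀})` on the interior top bonds of the WINDOW `D`.  The J4 top step imposes the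
normalisation (top) `κ′_k(y) = v₀(W̿₁^{(k)}; y₀, y)` on ALL of N05's top layer (LEAD-H Q3), and the linear junction of the (P3-top)
row (★w8-19936 g2) reads the same identity on every bond there.  THIS FILE proves it pointwise, for any set `T` of top sites carrying
(top): `dbarIterU_chart_eq_holT_contourT_of_top` (exact identity; the constant `C = g_k(y₀)⁻¹ν_k(y₀)` of the chart gauge cancels
against `W̿₁^{(k)} = (V̄♯)^{(g_k⁻¹ν_k)⁻¹}`), and the size corollary `norm_mlog_dbarIterU_chart_le_of_top`:
`‖log W̿^{(k)}((U♯)^{u⁻¹})(c)‖ ≤ 2·|c₋ − y₀|₁·ε₁` from `U ∈ fibre V`, `PlaqSmall ε₁ V` (✓`norm_holT_contourT_iter_sub_one_le`).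
[Balaban1985Averaging] (8), (92), (97)-(100); [Balaban1985Variational] (156).  Pure rewriting + one landed estimate.
-/

noncomputable section

open scoped BigOperators Matrix.Norms.L2Operator

namespace Summit.QuantumFields.YangMills.Theorems.P1FlatCoreDP1TopBonds

open Literature.MathematicalPhysics.QuantumFieldTheory.Balaban1983to89
open T4Continuum BlockAveraging ExpMeanLog MatrixLog
open T3ContinuumYM3Torus T3RegularMinimiser
open Literature.MathematicalPhysics.QuantumFieldTheory.Balaban1983to89.T3UnitLawDensityEML (ℰp)
open B5Eq118OneStroke (iterBlockOf)
open B10Eq27TorusAxialLog (unitsField toUField gaugeActT gaugeActT_apply holT contourT axialT rel holT_contourT_eq_gaugeActT)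
open B7Prop1Explicit (l1 e)
open B7Prop1Explicit renaming Site → LSite
open B7Prop1Local (InBox)
open T3ConstrainedMinimiser (fibre)
open Summit.QuantumFields.YangMills.Theorems.Prop8Chart (emlIterU)
open Summit.QuantumFields.YangMills.Theorems.Prop8ChartDoubleBar (dbarIterU vframeU gaugeActT_gaugeActT)
open Summit.QuantumFields.YangMills.Theorems.Prop7AxialGauge (axialT_gaugeActT)
open Summit.QuantumFields.YangMills.Theorems.P1FlatCoreFrameLinTower (dbarIterU_gaugeActT_eq_effGauge)
open Summit.QuantumFields.YangMills.Theorems.P1FlatCoreDP1Target (unitsField_toUField_iter_eq_emlIterU effGauge_const_mul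
  emlIterU_eq_gaugeActT_dbarIterU norm_holT_contourT_iter_sub_one_le)

variable (F : T3Family) (n K : ℕ)

/-- **(o) OFF THE WINDOW, EXACT.**  Pre-gauge `g` (descended `g_i`), correction `h′` with effective gauges `κ′_i` down the double-bar tower of
`W₁ = (U♯)^{g}`, accumulated frames `ν_i` of `W₁`, chart gauge `u⁻¹ = C·h′·g` with `C = g_k(y₀)⁻¹·ν_k(y₀)`, `y₀ = iterBlockOf (K-n) x`.
If (top) `κ′_k(y) = v₀(W̿₁^{(k)}; y₀, y)` holds on a set `T` of top sites, then for every top bond `c` with both ends in `T` whose axial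
contour does not wrap: `W̿^{(k)}((U♯)^{u⁻¹})(c) = V̄♯(Γ_{y₀,c₋} ∪ c ∪ Γ_{c₊,y₀})`, `V̄♯` the `(K-n)`-fold `ℰp`-average of `U` read in
`M₂(ℂ)ˣ` (fine-regular `U`: `10⁷L³ε₀ ≤ 1`, `PlaqSmall (regThreshold F n K ε₀) U`).  `DP1Clause` is the case `T = D.Om (K-n)`.
[cite: Balaban1985Averaging, (8) p.19, (92) p.31, (97)-(100) p.32; Balaban1985Variational, (156) p.302] -/
theorem dbarIterU_chart_eq_holT_contourT_of_top (x : Site (F.P K) 0)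
    (U : GaugeField (F.P K) 0 (Matrix.specialUnitaryGroup (Fin 2) ℂ)) (u : GaugeTransf (F.P K) 0 (Matrix.unitaryGroup (Fin 2) ℂ))
    (g h' : GaugeTransf (F.P K) 0 (Matrix (Fin 2) (Fin 2) ℂ)ˣ)
    (κ' : (i : ℕ) → GaugeTransf (F.P K) i (Matrix (Fin 2) (Fin 2) ℂ)ˣ) (h0' : κ' 0 = h')
    (hs' : ∀ (i : ℕ) (y : Site (F.P K) (i + 1)),
      κ' (i + 1) y = (vframeU (gaugeActT (κ' i) (dbarIterU i (gaugeActT g (unitsField (toUField U))))) y)⁻¹ * κ' i (emb y) *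
        vframeU (dbarIterU i (gaugeActT g (unitsField (toUField U)))) y)
    (ν : (i : ℕ) → Site (F.P K) i → (Matrix (Fin 2) (Fin 2) ℂ)ˣ) (hν0 : ∀ s, ν 0 s = 1)
    (hνs : ∀ (i : ℕ) (y : Site (F.P K) (i + 1)),
      ν (i + 1) y = ν i (emb y) * vframeU (dbarIterU i (gaugeActT g (unitsField (toUField U)))) y)
    (gs : (i : ℕ) → GaugeTransf (F.P K) i (Matrix (Fin 2) (Fin 2) ℂ)ˣ) (hg0 : gs 0 = g)
    (hgs : ∀ (i : ℕ) (y : Site (F.P K) (i + 1)), gs (i + 1) y = gs i (emb y))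
    {ε₀ : ℝ} (hε₀ : 0 < ε₀) (hε : 10 ^ 7 * (F.L : ℝ) ^ 3 * ε₀ ≤ 1) (hU : PlaqSmall (regThreshold F n K ε₀) U)
    (hug : ∀ s, (Unitary.toUnits (u s))⁻¹ =
      ((gs (K - n) (iterBlockOf (K - n) x))⁻¹ * ν (K - n) (iterBlockOf (K - n) x)) * h' s * g s)
    (T : Set (Site (F.P K) (K - n)))
    (hlam : ∀ y : Site (F.P K) (K - n), y ∈ T →
      κ' (K - n) y = axialT (dbarIterU (K - n) (gaugeActT g (unitsField (toUField U)))) (iterBlockOf (K - n) x) y)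
    (c : PBond (F.P K) (K - n)) (hsrc : c.src ∈ T) (htgt : c.tgt ∈ T)
    (hc : (rel (iterBlockOf (K - n) x) c.src c.dir + 1) * 2 ≤ ((F.P K).sitesPerDir (K - n) : ℤ)) :
    dbarIterU (K - n) (gaugeActT (fun s => (Unitary.toUnits (u s))⁻¹) (unitsField (toUField U))) c =
      holT (unitsField (toUField (Averaging.iter (fun i => BlockAveraging.blockAvg (P := F.P K) (j := i) ℰp) (K - n) U)))
        (iterBlockOf (K - n) x) (contourT (iterBlockOf (K - n) x) c) := by
  set C : (Matrix (Fin 2) (Fin 2) ℂ)ˣ := (gs (K - n) (iterBlockOf (K - n) x))⁻¹ * ν (K - n) (iterBlockOf (K - n) x) with hC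
  -- the charted field is the gauge copy of `W₁` by `C·h′`
  have hfun : (fun s => (Unitary.toUnits (u s))⁻¹) = fun s => C * h' s * g s := funext hug
  have hact : gaugeActT (fun s => (Unitary.toUnits (u s))⁻¹) (unitsField (toUField U)) =
      gaugeActT (fun s => C * h' s) (gaugeActT g (unitsField (toUField U))) := by
    rw [gaugeActT_gaugeActT, hfun]
  -- the effective gauges of `C·h′` are `C·κ′`
  have h0 : (fun (i : ℕ) (y : Site (F.P K) i) => C * κ' i y) 0 = fun s => C * h' s := by
    funext s; simp only [h0']
  have hD := dbarIterU_gaugeActT_eq_effGauge (gaugeActT g (unitsField (toUField U))) (fun s => C * h' s)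
    (fun (i : ℕ) (y : Site (F.P K) i) => C * κ' i y) h0 (effGauge_const_mul _ κ' hs' C) (K - n)
  rw [hact, hD, gaugeActT_apply, unitsField_toUField_iter_eq_emlIterU F n K hε₀ hε U hU (K - n) le_rfl,
    emlIterU_eq_gaugeActT_dbarIterU (unitsField (toUField U)) g ν hν0 hνs gs hg0 hgs (K - n),
    holT_contourT_eq_gaugeActT _ _ c hc, gaugeActT_apply, gaugeActT_apply, axialT_gaugeActT, axialT_gaugeActT]
  rw [hlam _ hsrc, hlam _ htgt, hC]
  group

/-- **(o) OFF THE WINDOW, SIZE.**  Under the hypotheses of `dbarIterU_chart_eq_holT_contourT_of_top`, for `U ∈ fibre V` with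
`PlaqSmall ε₁ V` (the stub's `InB` and `Reg7`) and a bond `c` of the (top)-set inside a box about `y₀` (`InBox lo hi` for `0`, `c₋ − y₀`,
`c₋ − y₀ + e_μ`) with `|c₋ − y₀|₁·ε₁ ≤ 1/2`: `‖log W̿^{(k)}((U♯)^{u⁻¹})(c)‖ ≤ 2·|c₋ − y₀|₁·ε₁` — the H42-top datum of the linear junction,
on all of the (top)-set, no unitarity side condition. [cite: Balaban1985Averaging, (8) p.19, pp.24-25, (97)-(100) p.32;
Balaban1985Variational, (156) p.302] -/
theorem norm_mlog_dbarIterU_chart_le_of_top (hnK : n ≤ K) (x : Site (F.P K) 0)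
    (V : GaugeField (F.P n) 0 (Matrix.specialUnitaryGroup (Fin 2) ℂ))
    (U : GaugeField (F.P K) 0 (Matrix.specialUnitaryGroup (Fin 2) ℂ)) (u : GaugeTransf (F.P K) 0 (Matrix.unitaryGroup (Fin 2) ℂ))
    (g h' : GaugeTransf (F.P K) 0 (Matrix (Fin 2) (Fin 2) ℂ)ˣ)
    (κ' : (i : ℕ) → GaugeTransf (F.P K) i (Matrix (Fin 2) (Fin 2) ℂ)ˣ) (h0' : κ' 0 = h')
    (hs' : ∀ (i : ℕ) (y : Site (F.P K) (i + 1)),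
      κ' (i + 1) y = (vframeU (gaugeActT (κ' i) (dbarIterU i (gaugeActT g (unitsField (toUField U))))) y)⁻¹ * κ' i (emb y) *
        vframeU (dbarIterU i (gaugeActT g (unitsField (toUField U)))) y)
    (ν : (i : ℕ) → Site (F.P K) i → (Matrix (Fin 2) (Fin 2) ℂ)ˣ) (hν0 : ∀ s, ν 0 s = 1)
    (hνs : ∀ (i : ℕ) (y : Site (F.P K) (i + 1)),
      ν (i + 1) y = ν i (emb y) * vframeU (dbarIterU i (gaugeActT g (unitsField (toUField U)))) y)
    (gs : (i : ℕ) → GaugeTransf (F.P K) i (Matrix (Fin 2) (Fin 2) ℂ)ˣ) (hg0 : gs 0 = g)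
    (hgs : ∀ (i : ℕ) (y : Site (F.P K) (i + 1)), gs (i + 1) y = gs i (emb y))
    {ε₀ ε₁ : ℝ} (hε₀ : 0 < ε₀) (hε : 10 ^ 7 * (F.L : ℝ) ^ 3 * ε₀ ≤ 1) (hU : PlaqSmall (regThreshold F n K ε₀) U)
    (hε₁ : 0 ≤ ε₁) (hUV : U ∈ fibre F ℰp n K hnK V) (hV : PlaqSmall ε₁ V)
    (hug : ∀ s, (Unitary.toUnits (u s))⁻¹ =
      ((gs (K - n) (iterBlockOf (K - n) x))⁻¹ * ν (K - n) (iterBlockOf (K - n) x)) * h' s * g s)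
    (T : Set (Site (F.P K) (K - n)))
    (hlam : ∀ y : Site (F.P K) (K - n), y ∈ T →
      κ' (K - n) y = axialT (dbarIterU (K - n) (gaugeActT g (unitsField (toUField U)))) (iterBlockOf (K - n) x) y)
    {lo hi : LSite (F.P K).d} (hlohi : ∀ i, lo i ≤ hi i) (hbox0 : InBox lo hi 0)
    (c : PBond (F.P K) (K - n)) (hsrc : c.src ∈ T) (htgt : c.tgt ∈ T)
    (hc : (rel (iterBlockOf (K - n) x) c.src c.dir + 1) * 2 ≤ ((F.P K).sitesPerDir (K - n) : ℤ))
    (hcb : InBox lo hi (rel (iterBlockOf (K - n) x) c.src)) (hce : InBox lo hi (rel (iterBlockOf (K - n) x) c.src + e c.dir))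
    (hsmall : l1 (rel (iterBlockOf (K - n) x) c.src) * ε₁ ≤ 1 / 2) :
    ‖mlog ((dbarIterU (K - n) (gaugeActT (fun s => (Unitary.toUnits (u s))⁻¹) (unitsField (toUField U))) c :
        (Matrix (Fin 2) (Fin 2) ℂ)ˣ) : Matrix (Fin 2) (Fin 2) ℂ)‖ ≤ 2 * (l1 (rel (iterBlockOf (K - n) x) c.src) * ε₁) := by
  rw [dbarIterU_chart_eq_holT_contourT_of_top F n K x U u g h' κ' h0' hs' ν hν0 hνs gs hg0 hgs hε₀ hε hU hug T hlam c hsrc htgt hc]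
  have h1 := norm_holT_contourT_iter_sub_one_le F n K hnK hε₁ V U hUV hV (iterBlockOf (K - n) x) hlohi hbox0 c hcb hce
  exact (norm_mlog_le_two_mul (h1.trans hsmall)).trans (by linarith)

end Summit.QuantumFields.YangMills.Theorems.P1FlatCoreDP1TopBonds

end
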